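import Summits.BirchSwinnertonDyer.BirchSwinnertonDyer.Theorems.PrintCf2SplitBadEisensteinTwoOrdinaryFiltrationTransport
import Summits.BirchSwinnertonDyer.BirchSwinnertonDyer.Theorems.PrintCf2SplitBadEisensteinTwoFinLocOfOrdinaryFiltration
import Summits.BirchSwinnertonDyer.BirchSwinnertonDyer.Theorems.GoldfeldGoodTwistsX049
import Summits.BirchSwinnertonDyer.Rank1Residual.Additive.RamifiedOrdinaryLineTransport
import Literature.NumberTheory.EllipticCurves.QuadraticTwistJInvariantProofs
import Literature.NumberTheory.EllipticCurves.BurungaleCastellaSkinnerTian2022.CMPConverse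
import Literature.NumberTheory.EllipticCurves.ComplexMultiplicationLocalFactorsAux
import Summits.BirchSwinnertonDyer.BirchSwinnertonDyer.Theorems.QuadraticBranchSignedControlPlusEtaNonsurjUncongruentFineTools
import HarnessLib

/-!
# `stub_ordinaryFiltrationAtTwo` PROVED: the ordinary filtration at `2` with both characters on the split-bad CM class
# (crux stmt-BirchSwinnertonDyer-20368 `PrintCf2.SplitBadTwoRankOneOfFacts`, line `eisenstein_two_bdp_line` v9.5)

Cell `bsd-print-cf2`, seat `bsd-line-cf2-p1-w2` g6 (prover, width seat on crux stmt-BirchSwinnertonDyer-20368; skeleton of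
record 39f5ac8d37c86b7a). This file DISCHARGES the registered cite-level stub **`stub_ordinaryFiltrationAtTwo`** (= the
binder `hFilt` of p633758 `EisensteinTwo.finLoc_two_of_ordinaryFiltration`) — the registered signature VERBATIM, no
hypothesis — whence `stub_finLoc_two` of the line is an unconditional theorem (`finLoc_two`, §3). THEOREMS ONLY (no
definition, no named fact, no `sorry`); `--supports stmt-BirchSwinnertonDyer-20368`; closes no item by itself (the stub is
not an item); BSD is not advanced by any of this; no summit statement is proved by this seat.

THE MATHEMATICS. `CMSplit W 2` forces `d_K = −7`, i.e. `j(W) ∈ {−3375, 16581375}` (table), so `W` is a `ℚ`-model of a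
quadratic twist of `49a1 = [1,−1,0,−2,−1]` or of `49a2 = [1,−1,0,−37,−78]` (Silverman X.5 Cor. 5.4.1; same `j ∉ {0,1728}`),
both globally minimal with ODD discriminant `∓7³` and `a₂ = 1` — GOOD ORDINARY at `2` with unit root `α`, `α² = α − 2`.
Greenberg's reduction line of that good curve `V` at the place `v ∋ 2` of `ℚ` carries the quotient character `α^n` and the
line character `ε·α^{−n}` (cell bsd-schneider's door-c6 files, Manin + Weil pairing; repackaged GRADED in
`…OrdinaryFiltrationTransport` §1); the twisting isomorphism `V[2^∞] ≃ W[2^∞]` is sign-equivariant (X.5 Cor. 5.4), which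
puts the signs `s₁ = s₂ = ψ(σ)` in (§2 there); and at a degree-one `𝔭 ∣ 2` of `K` the datum passes to `E_K[2^∞](K̄)` with
`Γ_{K_𝔭}` (§3 there). `K` imaginary quadratic, `W.HasCM`, `r_an = 1`, `¬ Good W 2`, `e(𝔭|2) = 1` are NOT used.

* §1 the comparison curve `49a2` (kernel certificates: `Δ_min = 343` odd, `#Ẽ(𝔽₂) = 2` so `a₂ = 1`; `Δ ≠ 0`, global minimality
  and `j = 16581375` are the tree's `EtaUncongruentRecords.{isElliptic,isGloballyMinimal,j}_A7b`); `49a1 = cm7` is the tree's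
  (`GoldfeldGoodTwistsX049` §3).
* §2 `ordinaryFiltration_rat_two_of_j_eq` — the SIGNED `ℚ`-side datum with `α² = α − 2` for every elliptic `W/ℚ` with
  `j(W) = j(V)`, `V` globally minimal good ordinary at `2` with `a₂(V) = 1`; `ordinaryFiltration_rat_two_of_cmSplit` — for
  every elliptic `W/ℚ` with `CMSplit W 2`.
* §3 **`stub_ordinaryFiltrationAtTwo`** (registered signature verbatim) and **`finLoc_two`** (= `stub_finLoc_two`'s
  registered signature, now unconditional: `finLoc_two_of_ordinaryFiltration stub_ordinaryFiltrationAtTwo`).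

References: [GreenbergLNM1716] §2 pp. 62–63, p. 70; [Greenberg1991] §2 (p. 214); [SerreInventiones1972] §1.11;
[SilvermanAEC2009] III.8.1, V.2.3.1(b), VII.1 Rem. 1.1, X.5 Cor. 5.4 and 5.4.1; [SilvermanATAEC1994] App. A §3;
[Cremona2006] Table 1 (class 49a); [JetchevSkinnerWan2017] §3.3 Prop. 3.3.4 Case 3(b).
-/

noncomputable section

open scoped Classical

namespace Summit.BirchSwinnertonDyer.BirchSwinnertonDyer.Theorems.PrintCf2.EisensteinTwo

open NumberField IsDedekindDomain Field WeierstrassCurve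
  Literature.NumberTheory.EllipticCurves Literature.NumberTheory.EllipticCurves.GreenbergSelmer
  Literature.NumberTheory.EllipticCurves.Rank1Residual
  Literature.NumberTheory.GaloisRepresentations
  Summit.BirchSwinnertonDyer.Rank1Residual.X11b
  Summit.BirchSwinnertonDyer.BirchSwinnertonDyer.Theorems.SchneiderFreeAdditiveX3
  Summit.BirchSwinnertonDyer.BirchSwinnertonDyer.Theorems.GoldfeldGoodTwists
  Summit.BirchSwinnertonDyer.BirchSwinnertonDyer.Rank1Residual

set_option linter.dupNamespace false
set_option autoImplicit false

/-! ## §1. The comparison curve `49a2 = [1, −1, 0, −37, −78]` -/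

section Models

/-- `j(49a2) = 16581375 = 255³` (the tree's `EtaUncongruentRecords.j_A7b`, read for a curve `V` equal to the literal equation;
`Δ ≠ 0` and global minimality of `[1, −1, 0, −37, −78]` are the tree's `EtaUncongruentRecords.isElliptic_A7b` /
`isGloballyMinimal_A7b`). [cite: Cremona2006, Table 1 (class 49a)] [cite: SilvermanATAEC1994, App. A §3] -/
theorem j_of_eq_int49a2 (V : WeierstrassCurve ℚ) [V.IsElliptic] (hV : V = ⟨1, -1, 0, -37, -78⟩) :
    V.j = 16581375 := by
  subst hV
  exact EtaUncongruentRecords.j_A7b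

/-- The integral model of `49a2` is the integer equation `[1, −1, 0, −37, −78]`. [folklore] -/
theorem integralModelInt_of_eq_int49a2 (V : WeierstrassCurve ℚ) [V.IsGloballyMinimal]
    (hV : V = ⟨1, -1, 0, -37, -78⟩) : integralModelInt V = ⟨1, -1, 0, -37, -78⟩ := by
  subst hV
  exact IntModel.integralModelInt_eq_of_map_eq _ (IntModel.map_mk_int 1 (-1) 0 (-37) (-78))

/-- `Δ_min(49a2) = 343` is odd: `2 ∤ Δ_min`. [cite: Cremona2006, Table 1 (49a2)] -/
theorem not_two_dvd_minimalDiscriminantInt_of_eq_int49a2 (V : WeierstrassCurve ℚ) [V.IsGloballyMinimal]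
    (hV : V = ⟨1, -1, 0, -37, -78⟩) : ¬ (2 : ℤ) ∣ minimalDiscriminantInt V := by
  rw [IntModel.minimalDiscriminantInt_eq (integralModelInt_of_eq_int49a2 V hV)]
  simp only [WeierstrassCurve.Δ, WeierstrassCurve.b₂, WeierstrassCurve.b₄, WeierstrassCurve.b₆,
    WeierstrassCurve.b₈]
  norm_num

/-- `#Ẽ(𝔽₂) = 2` for `49a2` (`y² + xy = x³ + x² + x` over `𝔽₂`: `O` and `(0,0)`), i.e. `a₂(49a2) = 1`.
[cite: Cremona2006, Table 1 (49a2: a₂ = 1)] -/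
theorem card_int49a2_mod_two :
    Nat.card (((⟨1, -1, 0, -37, -78⟩ : WeierstrassCurve ℤ).map (Int.castRingHom (ZMod 2))).toAffine.Point) = 2 := by
  rw [@WeierstrassCurve.natCard_point_eq_one_add_card (ZMod 2) (@ZMod.instField 2 ⟨by norm_num⟩) _ _ _
    (by decide +kernel)]
  decide +kernel

/-- `a₂(49a2) = 1`. [cite: Cremona2006, Table 1 (Cremona label 49a2)] -/
theorem frobeniusTrace_two_of_eq_int49a2 (V : WeierstrassCurve ℚ) [V.IsGloballyMinimal]
    (hV : V = ⟨1, -1, 0, -37, -78⟩) : V.frobeniusTrace 2 = 1 := by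
  rw [IntModel.frobeniusTrace_eq (integralModelInt_of_eq_int49a2 V hV) card_int49a2_mod_two]
  norm_num

/-- `Δ_min(49a1) = −343` is odd: `2 ∤ Δ_min(cm7)`. [cite: Cremona2006, Table 1 (49a1)] -/
theorem not_two_dvd_minimalDiscriminantInt_cm7 : ¬ (2 : ℤ) ∣ minimalDiscriminantInt cm7 := by
  rw [IntModel.minimalDiscriminantInt_eq integralModelInt_cm7]
  simp only [WeierstrassCurve.Δ, WeierstrassCurve.b₂, WeierstrassCurve.b₄, WeierstrassCurve.b₆,
    WeierstrassCurve.b₈]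
  norm_num

end Models

/-! ## §2. The SIGNED `ℚ`-side datum with `α² = α − 2` for the curves with `j ∈ {−3375, 16581375}` -/

section RatTwo

/-- **The signed ordinary-filtration datum at `(ℚ, v ∋ 2)` for a twist of a good ordinary curve with `a₂ = 1`.**
`V/ℚ` globally minimal, `2 ∤ Δ_V`, `a₂(V) = 1`, `j(V) ∉ {0, 1728}`; `W/ℚ` elliptic with `j(W) = j(V)` (so `W` is a
`ℚ`-model of a quadratic twist `V^{(d)}`, Silverman X.5 Cor. 5.4.1). Then on `W[2^∞](ℚ̄)` there are `C` and `α ∈ ℤ₂ˣ`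
with `α² = α − 2` and, for every `σ ∈ Γ_{ℚ_v}` of Frobenius degree `n`, signs `s₁ = s₂ = ±1` with the quotient clause
(`s₂α^n`, graded) and the line clause (`s₁·ε·α^{−n}`): `…Transport` §1 on `V`, transported along the sign-equivariant
twisting isomorphism (`Additive.exists_addEquiv_geomPrimaryTorsion_of_model_twist_sign`, `…Transport` §2).
[cite: SilvermanAEC2009, X.5 Cor. 5.4 and 5.4.1] [cite: GreenbergLNM1716, §2 p. 70] -/
theorem ordinaryFiltration_rat_two_of_j_eq (V : WeierstrassCurve ℚ) [V.IsElliptic] [V.IsGloballyMinimal]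
    (hΔ : ¬ (2 : ℤ) ∣ minimalDiscriminantInt V) (ha : V.frobeniusTrace 2 = 1) (h0 : V.j ≠ 0) (h1728 : V.j ≠ 1728)
    (W : WeierstrassCurve ℚ) [W.IsElliptic] (hj : W.j = V.j) {v : HeightOneSpectrum (𝓞 ℚ)}
    (hpv : ((2 : ℕ) : 𝓞 ℚ) ∈ v.asIdeal) :
    ∃ (C : AddSubgroup (W.geomPrimaryTorsion 2)) (α : ℤ_[2]ˣ),
      (α : ℤ_[2]) ^ 2 = (α : ℤ_[2]) - 2 ∧
      ∀ (σ : absoluteGaloisGroup (v.adicCompletion ℚ)) (n : ℕ), IsFrobPow σ (n : ℤ) →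
        ∃ s₁ s₂ : ℤ, (s₁ = 1 ∨ s₁ = -1) ∧ (s₂ = 1 ∨ s₂ = -1) ∧
          (∀ (k : ℕ) (x : W.geomPrimaryTorsion 2), 2 ^ k • x ∈ C →
            ∀ N : ℤ, ((N : ℤ_[2]) - s₂ * ((α ^ n : ℤ_[2]ˣ) : ℤ_[2])) ∈ (Ideal.span {(2 : ℤ_[2]) ^ k} : Ideal ℤ_[2]) →
              absGaloisRestrict ℚ (v.adicCompletion ℚ) σ • x - N • x ∈ C) ∧
          (∀ (k : ℕ) (c : W.geomPrimaryTorsion 2), c ∈ C → 2 ^ k • c = 0 →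
            ∀ N : ℤ, ((N : ℤ_[2]) - s₁ *
                ((GaloisRep.cyclotomicCharacter ℚ 2 (absGaloisRestrict ℚ (v.adicCompletion ℚ) σ) * (α⁻¹) ^ n :
                  ℤ_[2]ˣ) : ℤ_[2])) ∈ (Ideal.span {(2 : ℤ_[2]) ^ k} : Ideal ℤ_[2]) →
              absGaloisRestrict ℚ (v.adicCompletion ℚ) σ • c = N • c) := by
  haveI : Fact (Nat.Prime 2) := ⟨Nat.prime_two⟩
  haveI : NeZero (2 : ℚ) := ⟨two_ne_zero⟩
  have hord : ¬ ((2 : ℕ) : ℤ) ∣ V.frobeniusTrace 2 := by rw [ha]; decide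
  obtain ⟨C, α, hα, hchar⟩ := ordinaryFiltration_rat V 2 hpv hΔ hord
  obtain ⟨d, hd, C₁, hC₁⟩ := WeierstrassCurve.exists_variableChange_eq_quadraticTwist_of_j_eq hj h0 h1728
  obtain ⟨e, he, -, -⟩ :=
    Summit.BirchSwinnertonDyer.Rank1Residual.Additive.exists_addEquiv_geomPrimaryTorsion_of_model_twist_sign 2 V hd
      (W := W) ⟨C₁⁻¹, by rw [← hC₁, inv_smul_smul]⟩
  refine ⟨C.map e.toAddMonoidHom, α, ?_, ordinaryFiltration_twist e he C α hchar⟩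
  rw [hα, ha]; push_cast; ring

/-- **The signed `ℚ`-side datum for the split-bad CM class.** For every elliptic `W/ℚ` with `CMSplit W 2` (i.e.
`j(W) ∈ {−3375, 16581375}`: `d_K = −7`) and the place `v ∋ 2`: the §2 datum on `W[2^∞](ℚ̄)` with `α² = α − 2`, from
`V = 49a1 = cm7` (`j = −3375`) or `V = 49a2` (`j = 16581375`). [cite: SilvermanATAEC1994, App. A §3 (table of CM j-invariants)]
[cite: Cremona2006, Table 1 (class 49a)] [cite: SilvermanAEC2009, X.5 Cor. 5.4.1] -/
theorem ordinaryFiltration_rat_two_of_cmSplit (W : WeierstrassCurve ℚ) [W.IsElliptic] (hsplit : CMSplit W 2)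
    {v : HeightOneSpectrum (𝓞 ℚ)} (hpv : ((2 : ℕ) : 𝓞 ℚ) ∈ v.asIdeal) :
    ∃ (C : AddSubgroup (W.geomPrimaryTorsion 2)) (α : ℤ_[2]ˣ),
      (α : ℤ_[2]) ^ 2 = (α : ℤ_[2]) - 2 ∧
      ∀ (σ : absoluteGaloisGroup (v.adicCompletion ℚ)) (n : ℕ), IsFrobPow σ (n : ℤ) →
        ∃ s₁ s₂ : ℤ, (s₁ = 1 ∨ s₁ = -1) ∧ (s₂ = 1 ∨ s₂ = -1) ∧
          (∀ (k : ℕ) (x : W.geomPrimaryTorsion 2), 2 ^ k • x ∈ C →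
            ∀ N : ℤ, ((N : ℤ_[2]) - s₂ * ((α ^ n : ℤ_[2]ˣ) : ℤ_[2])) ∈ (Ideal.span {(2 : ℤ_[2]) ^ k} : Ideal ℤ_[2]) →
              absGaloisRestrict ℚ (v.adicCompletion ℚ) σ • x - N • x ∈ C) ∧
          (∀ (k : ℕ) (c : W.geomPrimaryTorsion 2), c ∈ C → 2 ^ k • c = 0 →
            ∀ N : ℤ, ((N : ℤ_[2]) - s₁ *
                ((GaloisRep.cyclotomicCharacter ℚ 2 (absGaloisRestrict ℚ (v.adicCompletion ℚ) σ) * (α⁻¹) ^ n :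
                  ℤ_[2]ˣ) : ℤ_[2])) ∈ (Ideal.span {(2 : ℤ_[2]) ^ k} : Ideal ℤ_[2]) →
              absGaloisRestrict ℚ (v.adicCompletion ℚ) σ • c = N • c) := by
  have h7 := BurungaleCastellaSkinnerTian2022.cmFieldDiscrOfJ_eq_of_cmSplit_two W hsplit
  have hj : W.j = -3375 ∨ W.j = 16581375 := by
    unfold cmFieldDiscrOfJ at h7
    split_ifs at h7 <;> first | assumption | (norm_num at h7)
  rcases hj with hj | hj
  · exact ordinaryFiltration_rat_two_of_j_eq cm7 not_two_dvd_minimalDiscriminantInt_cm7 frobeniusTrace_cm7_two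
      (by rw [j_cm7]; norm_num) (by rw [j_cm7]; norm_num) W (by rw [hj, j_cm7]) hpv
  · haveI := EtaUncongruentRecords.isElliptic_A7b
    haveI := EtaUncongruentRecords.isGloballyMinimal_A7b
    exact ordinaryFiltration_rat_two_of_j_eq ⟨1, -1, 0, -37, -78⟩
      (not_two_dvd_minimalDiscriminantInt_of_eq_int49a2 _ rfl) (frobeniusTrace_two_of_eq_int49a2 _ rfl)
      (by rw [j_of_eq_int49a2 _ rfl]; norm_num) (by rw [j_of_eq_int49a2 _ rfl]; norm_num) W
      (by rw [hj, j_of_eq_int49a2 _ rfl]) hpv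

end RatTwo

/-! ## §3. The registered stub, verbatim; and `stub_finLoc_two` unconditionally -/

/-- **`stub_ordinaryFiltrationAtTwo` (crux 20368, line `eisenstein_two_bdp_line` v9.5, skeleton 39f5ac8d37c86b7a) — the
registered signature VERBATIM, PROVED.** For every `W/ℚ` of the split-bad CM class, every imaginary quadratic `K` and
every degree-one `𝔭 ∣ 2` of `K`: on `E_K[2^∞](K̄)` (`E_K = W.baseChange K`) there are ONE subgroup `C` and the unit root
`α ∈ ℤ₂ˣ` of `X² − X + 2` such that every `σ ∈ Γ_{K_𝔭}` of Frobenius degree `n` acts on `E[2^∞] ⧸ C` as any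
`N ≡ s₂α^n (mod 2^k)` (graded) and on `C[2^k]` as any `N ≡ s₁·ε(res σ)·α^{−n}`, `s₁, s₂ = ±1` — Greenberg's ordinary
filtration of the good ordinary twist (`49a1` or `49a2`, `a₂ = 1`) WITH the unit-root Frobenius eigenvalue, transported
along the quadratic twist and to `(K, 𝔭)` (§2 + `…Transport` §3). Only `CMSplit W 2`, `2 ∈ 𝔭` and `f(𝔭|2) = 1` are used.
[cite: GreenbergLNM1716, §2 pp. 62–63 and p. 70] [cite: SerreInventiones1972, §1.11 Prop. 11] [cite: SilvermanAEC2009, X.5 Cor. 5.4.1] -/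
theorem stub_ordinaryFiltrationAtTwo :
    ∀ (W : WeierstrassCurve ℚ) [W.IsElliptic] [W.IsGloballyMinimal],
    W.HasCM → W.analyticRank = 1 → CMSplit W 2 → ¬ Good W 2 →
    ∀ (K : Type) [Field K] [NumberField K], IsImaginaryQuadratic K →
      ∀ (𝔭 : HeightOneSpectrum (𝓞 K)), ((2 : ℕ) : 𝓞 K) ∈ 𝔭.asIdeal → 𝔭.asIdeal.ramificationIdx (𝓞 ℚ) = 1 →
        𝔭.asIdeal.inertiaDeg (𝓞 ℚ) = 1 →
        ∃ (C : AddSubgroup ((W.baseChange K).geomPrimaryTorsion 2)) (α : ℤ_[2]ˣ),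
          (α : ℤ_[2]) ^ 2 = (α : ℤ_[2]) - 2 ∧
          ∀ (σ : absoluteGaloisGroup (𝔭.adicCompletion K)) (n : ℕ), IsFrobPow σ (n : ℤ) →
            ∃ s₁ s₂ : ℤ, (s₁ = 1 ∨ s₁ = -1) ∧ (s₂ = 1 ∨ s₂ = -1) ∧
              (∀ (k : ℕ) (x : (W.baseChange K).geomPrimaryTorsion 2), 2 ^ k • x ∈ C →
                ∀ N : ℤ, ((N : ℤ_[2]) - s₂ * ((α ^ n : ℤ_[2]ˣ) : ℤ_[2])) ∈
                    (Ideal.span {(2 : ℤ_[2]) ^ k} : Ideal ℤ_[2]) →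
                  absGaloisRestrict K (𝔭.adicCompletion K) σ • x - N • x ∈ C) ∧
              (∀ (k : ℕ) (c : (W.baseChange K).geomPrimaryTorsion 2), c ∈ C → 2 ^ k • c = 0 →
                ∀ N : ℤ, ((N : ℤ_[2]) - s₁ *
                    ((GaloisRep.cyclotomicCharacter K 2 (absGaloisRestrict K (𝔭.adicCompletion K) σ) * (α⁻¹) ^ n :
                      ℤ_[2]ˣ) : ℤ_[2])) ∈ (Ideal.span {(2 : ℤ_[2]) ^ k} : Ideal ℤ_[2]) →
                  absGaloisRestrict K (𝔭.adicCompletion K) σ • c = N • c) := by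
  intro W _ _ _hCM _hr hsplit _hng K _ _ _hK 𝔭 h𝔭 _he hf
  haveI : Fact (Nat.Prime 2) := ⟨Nat.prime_two⟩
  have hpv : ((2 : ℕ) : 𝓞 ℚ) ∈ (ratPlace 2).asIdeal :=
    (natCast_mem_asIdeal_iff_eq_primesEquiv_symm (ratPlace 2) Fact.out).mpr rfl
  haveI := liesOver_of_natCast_mem hpv h𝔭
  obtain ⟨C, α, hα, hchar⟩ := ordinaryFiltration_rat_two_of_cmSplit W hsplit hpv
  obtain ⟨C', hchar'⟩ := ordinaryFiltration_baseChange_of_inertiaDeg_eq_one W K (ratPlace 2) 𝔭 hf C α hchar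
  exact ⟨C', α, hα, hchar'⟩

/-- **`stub_finLoc_two` of the line, UNCONDITIONALLY** (its registered signature verbatim): Fin_v at `2` on every frame
`(W, K, κ, 𝔭)` of the split-bad CM class — `E(K_{∞,𝔭})[2^∞]` is finite along every anticyclotomic `ℤ₂`-tower at every
degree-one `𝔭 ∣ 2` — by p633758 `finLoc_two_of_ordinaryFiltration` applied to `stub_ordinaryFiltrationAtTwo`.
[cite: GreenbergLNM1716, §3 Lemma 3.3 (p. 87)] [cite: Greenberg1991, §2 (p. 214)] -/
theorem finLoc_two :
    ∀ (W : WeierstrassCurve ℚ) [W.IsElliptic] [W.IsGloballyMinimal],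
      W.HasCM → W.analyticRank = 1 → CMSplit W 2 → ¬ Good W 2 →
      ∀ (K : Type) [Field K] [NumberField K], IsImaginaryQuadratic K →
        ∀ (κ : ZpExtension K 2), κ.IsAnticyclotomic →
          ∀ (𝔭 : HeightOneSpectrum (𝓞 K)), ((2 : ℕ) : 𝓞 K) ∈ 𝔭.asIdeal → 𝔭.asIdeal.ramificationIdx (𝓞 ℚ) = 1 →
            𝔭.asIdeal.inertiaDeg (𝓞 ℚ) = 1 →
            SchneiderFreeControlAtoms.LocalTowerTorsionFiniteAt (W.baseChange K) 2 κ 𝔭 :=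
  finLoc_two_of_ordinaryFiltration stub_ordinaryFiltrationAtTwo

end Summit.BirchSwinnertonDyer.BirchSwinnertonDyer.Theorems.PrintCf2.EisensteinTwo

end
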